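import Literature.AlgebraicGeometry.Resolution.BlowupSequencesSingleOff
import Literature.AlgebraicGeometry.Resolution.RegularCentreBlowupSeqExtension
import Literature.AlgebraicGeometry.Resolution.MarkedIdealsRestrict
import Literature.AlgebraicGeometry.Resolution.BlowupSequencesExtensions
import Literature.AlgebraicGeometry.Resolution.BoundaryEquivalence
import Literature.AlgebraicGeometry.Resolution.KollarGlobalization
import Literature.AlgebraicGeometry.Resolution.BlowupSequencesLocalIsoDescent
import Literature.AlgebraicGeometry.Resolution.SubschemeRegularStalks
import Literature.AlgebraicGeometry.Resolution.SNCStrataSmooth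
import Literature.AlgebraicGeometry.Resolution.CanonicalResolution
import HarnessLib

/-!
# Extending a multiple blow-up of a marked ideal from an open subscheme (closure of the centres)

Topic: `Literature/AlgebraicGeometry/Resolution`. The classical device for passing from LOCAL
blow-up sequences to global ones: a sequence of blowings up of an open `U ⊆ X` whose centres are
closed in (the towers over) `X` extends to `X` by blowing up, at each stage, the SAME centre —
the reduced closed subscheme on the closure of its image (here equal to the image), Bierstone–
Grigoriev–Milman–Włodarczyk 2011, Def. 3.1.5 Remark (1) / Thm. 8.0.5 (2) ("the induced sequence
`φ^*(X_i)` … is an extension of the resolution of `φ^*(X, 𝓘, E, μ)`") read backwards for an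
open immersion `φ = j`, and J. Kollár, *Lectures on Resolution of Singularities* (2007),
Thm. 3.105 (proof, "the subschemes `Z'_0 ∩ U_{x_i}` glue together to a subscheme `Z_0 ⊂ X` … we
obtain `X_1 := B_{Z_0} X` such that `X'_1 = X' ×_X X_1`") in the case of ONE chart. The tree's
`RegularCentreBlowupSeqExtension.lean` does this for Cossart–Piltant sequences
(`IsRegularCentreBlowupSeq`); this file does it for the data-level multiple blow-ups of marked
ideals (`CentreSeq`, `CentreSeq.IsAdmissibleFor`, `CentreSeq.IsPullbackAlong`):

* `comap_vanishingIdeal_closureImage_support`, `support_vanishingIdeal_closureImage_subset`,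
  `exists_eq_of_mem_support_vanishingIdeal_closureImage` — the extended centre
  `Z = 𝓘(closure j(V(C)))` of a radical centre `C` on `U` whose support lies over a closed
  `T ⊆ j(U)`: `j^*Z = C`, `V(Z) ⊆ T`, and every point of `V(Z)` is `j u` with `u ∈ V(C)`;
* `isRegular_subscheme_vanishingIdeal_closureImage` — `V(Z) ≅ V(C)` is regular if `V(C)` is;
* `HasSNC.hasSNCWith_vanishingIdeal_closureImage` — if `E` has simple normal crossings on `X`
  and `j^*E` has simple normal crossings with `C`, then `E` has simple normal crossings with `Z`
  (the adapted regular system of parameters at `u` transports along `𝒪_{X, j u} ≅ 𝒪_{U, u}`; the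
  labels stay injective by the stalk-injectivity of an snc boundary,
  `HasSNCWith.injOn_stalkIdeal`);
* **`CentreSeq.exists_extend_of_centresOver`** — for `j : U → X` an open immersion into a
  locally Noetherian `X`, a marked ideal `M = (X, 𝓘, E, μ)` with `E` snc, a closed `T ⊆ j(U)`,
  and a multiple blow-up `s` of `j^*M` (`IsAdmissibleFor`) all of whose centres lie over
  `j⁻¹ T` (`CentresOver`): there is a multiple blow-up `t` of `M` on `X`, with centres over `T`,
  inducing `s` along `j` (`IsPullbackAlong j t s`: the same centres, the towers over `U` being
  the preimages of `U`).

## Sources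

* E. Bierstone, D. Grigoriev, P. Milman, J. Włodarczyk, arXiv:1206.3090: Def. 3.1.3, Def. 3.1.5
  Remark (1), Thm. 8.0.5 (2). [BierstoneGrigorievMilmanWlodarczyk2011]
* J. Kollár, *Lectures on Resolution of Singularities* (2007): Thm. 3.105 (proof), Prop. 3.37. [Kollar2007]
* U. Görtz, T. Wedhorn, *Algebraic Geometry I* (2020), Prop. 13.91 (blow-ups commute with flat
  base change; open immersions). [GortzWedhorn2020]
-/

noncomputable section

open CategoryTheory CategoryTheory.Limits AlgebraicGeometry TopologicalSpace IsLocalRing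
  Scheme.IdealSheafData

namespace Literature.AlgebraicGeometry.Resolution

universe u

/-! ## The extended centre -/

section Centre

variable {U X : Scheme.{u}} (j : U ⟶ X) [IsOpenImmersion j]

/-- **The extended centre restricts to the centre**: `j^* 𝓘(closure j(V(C))) = C` for a radical
ideal sheaf `C` on the open `U` (an open immersion is an embedding, so `j⁻¹(closure j V(C)) = V(C)`,
and a radical ideal sheaf is the vanishing ideal of its support).
[cite: BierstoneGrigorievMilmanWlodarczyk2011, Def. 3.1.5 Remark (1)] -/
theorem comap_vanishingIdeal_closureImage_support {C : U.IdealSheafData} (hC : C.radical = C) :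
    (vanishingIdeal (closureImage j (C.support : Set U))).comap j = C := by
  rw [comap_vanishingIdeal_closureImage j C.support, ← eq_vanishingIdeal_support hC]

omit [IsOpenImmersion j] in
/-- The support of the extended centre is the closure of `j(V(C))`; it lies in every closed
`T ⊇ j(V(C))`. [cite: Kollar2007, Thm. 3.105 (proof)] -/
theorem support_vanishingIdeal_closureImage_subset {C : U.IdealSheafData} {T : Set X}
    (hT : IsClosed T) (hCT : (C.support : Set U) ⊆ j ⁻¹' T) :
    ((vanishingIdeal (closureImage j (C.support : Set U))).support : Set X) ⊆ T := by
  rw [coe_support_vanishingIdeal, coe_closureImage]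
  exact hT.closure_subset_iff.mpr (Set.image_subset_iff.mpr hCT)

/-- Every point of the extended centre is `j u` with `u ∈ V(C)`, provided `T ⊆ j(U)`.
[cite: Kollar2007, Thm. 3.105 (proof)] -/
theorem exists_eq_of_mem_support_vanishingIdeal_closureImage {C : U.IdealSheafData}
    (hC : C.radical = C) {T : Set X} (hT : IsClosed T) (hTj : T ⊆ Set.range j)
    (hCT : (C.support : Set U) ⊆ j ⁻¹' T) {y : X}
    (hy : y ∈ (vanishingIdeal (closureImage j (C.support : Set U))).support) :
    ∃ u : U, j u = y ∧ u ∈ C.support := by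
  obtain ⟨u, rfl⟩ := hTj (support_vanishingIdeal_closureImage_subset j hT hCT hy)
  refine ⟨u, rfl, ?_⟩
  have : u ∈ ((vanishingIdeal (closureImage j (C.support : Set U))).comap j).support := by
    rw [support_comap]; exact hy
  rwa [comap_vanishingIdeal_closureImage_support j hC] at this

/-- The stalk of the extended centre at `j u` corresponds to the stalk of `C` at `u` under
`𝒪_{X, j u} ≅ 𝒪_{U, u}` (blow-ups and their centres commute with open immersions, GW Prop. 13.91).
[cite: GortzWedhorn2020, Prop. 13.91] -/
theorem stalkIdeal_vanishingIdeal_closureImage_eq_map {C : U.IdealSheafData} (hC : C.radical = C)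
    (u : U) :
    stalkIdeal (vanishingIdeal (closureImage j (C.support : Set U))) (j u) =
      (stalkIdeal C u).map (stalkEquivOfIsLocalIso j u).symm := by
  rw [stalkIdeal_eq_map_symm_of_isLocalIso j, comap_vanishingIdeal_closureImage_support j hC]

/-- **`V(Z) ≅ V(C)` is regular** (the local rings of `V(Z)` are the `𝒪_{X, j u}/Z_{j u} ≅ 𝒪_{U,u}/C_u
≅ 𝒪_{V(C), c}`), `X` locally Noetherian, `T ⊆ j(U)` closed containing the centre.
[cite: BierstoneGrigorievMilmanWlodarczyk2011, Def. 3.1.3 (1)] -/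
theorem isRegular_subscheme_vanishingIdeal_closureImage [IsLocallyNoetherian X]
    {C : U.IdealSheafData} (hCreg : Scheme.IsRegular C.subscheme) {T : Set X} (hT : IsClosed T)
    (hTj : T ⊆ Set.range j) (hCT : (C.support : Set U) ⊆ j ⁻¹' T) :
    Scheme.IsRegular (vanishingIdeal (closureImage j (C.support : Set U))).subscheme := by
  haveI : IsReduced C.subscheme := hCreg.isReduced
  have hC : C.radical = C := radical_eq_of_isReduced_subscheme C
  refine Scheme.isRegular_subscheme_of_forall _ fun y hy => ?_
  obtain ⟨u, rfl, hu⟩ := exists_eq_of_mem_support_vanishingIdeal_closureImage j hC hT hTj hCT hy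
  obtain ⟨c, hc⟩ : u ∈ Set.range C.subschemeι := by rw [range_subschemeι]; exact hu
  haveI := hCreg c
  have e₂ := (nonempty_stalkSubschemeEquiv C c).some
  subst hc
  haveI : IsRegularLocalRing
      (U.presheaf.stalk (C.subschemeι c) ⧸ stalkIdeal C (C.subschemeι c)) :=
    IsRegularLocalRing.of_ringEquiv e₂.symm
  rw [stalkIdeal_vanishingIdeal_closureImage_eq_map j hC]
  exact IsRegularLocalRing.of_ringEquiv
    (Ideal.quotientEquiv _ _ (stalkEquivOfIsLocalIso j (C.subschemeι c)).symm rfl)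

/-- **`E` has simple normal crossings with the extended centre** if `E` has simple normal
crossings on `X` and `j^*E` has simple normal crossings with `C` on `U` (`C` radical, its support
over a closed `T ⊆ j(U)`): at `j u` the regular system of parameters of `𝒪_{U,u}` adapted to
`j^*E` and `C` transports along `𝒪_{X, j u} ≅ 𝒪_{U,u}`; distinct members of `E` through `j u`
have distinct restrictions (stalk-injectivity of the snc boundary `E`,
`HasSNCWith.injOn_stalkIdeal`). [cite: BierstoneGrigorievMilmanWlodarczyk2011, Def. 3.1.3 (2)] -/
theorem HasSNC.hasSNCWith_vanishingIdeal_closureImage {E : List X.IdealSheafData} (hE : HasSNC E)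
    {C : U.IdealSheafData} (hC : C.radical = C) (h : HasSNCWith (E.map (·.comap j)) C)
    {T : Set X} (hT : IsClosed T) (hTj : T ⊆ Set.range j) (hCT : (C.support : Set U) ⊆ j ⁻¹' T) :
    HasSNCWith E (vanishingIdeal (closureImage j (C.support : Set U))) := by
  classical
  intro y
  by_cases hy : y ∈ (vanishingIdeal (closureImage j (C.support : Set U))).support
  swap
  · obtain ⟨hreg, w, hw, hι, -⟩ := hE y
    exact ⟨hreg, w, hw, hι, fun h => absurd h hy⟩
  obtain ⟨x', rfl, hx'C⟩ := exists_eq_of_mem_support_vanishingIdeal_closureImage j hC hT hTj hCT hy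
  obtain ⟨hreg', u', hu', ⟨ι', hι', hι'D⟩, hC'⟩ := h x'
  haveI := hreg'
  set e := stalkEquivOfIsLocalIso j x' with he_def
  haveI hreg : IsRegularLocalRing (X.presheaf.stalk (j x')) := IsRegularLocalRing.of_ringEquiv e.symm
  refine ⟨hreg, ?_⟩
  -- the embedding dimensions agree
  have hrank : (maximalIdeal (X.presheaf.stalk (j x'))).spanFinrank =
      (maximalIdeal (U.presheaf.stalk x')).spanFinrank := by
    rw [← map_ringEquiv_maximalIdeal e, Ideal.spanFinrank_map_eq_of_ringEquiv]
  let σ : Fin (maximalIdeal (X.presheaf.stalk (j x'))).spanFinrank ≃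
      Fin (maximalIdeal (U.presheaf.stalk x')).spanFinrank := finCongr hrank
  let u : Fin (maximalIdeal (X.presheaf.stalk (j x'))).spanFinrank → X.presheaf.stalk (j x') :=
    fun i => e.symm (u' (σ i))
  have huσ : ∀ i, u (σ.symm i) = e.symm (u' i) := fun i => by
    simp only [u, Equiv.apply_symm_apply]
  refine ⟨u, ?_, ?_, ?_⟩
  · -- `(u) = 𝔪_{j x'}`
    have hr : Set.range u = e.symm '' Set.range u' := by
      rw [show u = (fun i => e.symm (u' i)) ∘ σ from rfl, σ.surjective.range_comp]
      exact Set.range_comp _ u'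
    rw [hr, ← Ideal.map_span e.symm, hu', map_ringEquiv_maximalIdeal]
  · -- the boundary components through `j x'`
    let θ : {D // D ∈ E ∧ j x' ∈ D.support} → {D' // D' ∈ E.map (·.comap j) ∧ x' ∈ D'.support} :=
      fun D => ⟨D.1.comap j, List.mem_map.mpr ⟨D.1, D.2.1, rfl⟩, by
        rw [Scheme.IdealSheafData.support_comap]; exact D.2.2⟩
    have hθ : Function.Injective θ := by
      intro D₁ D₂ hD
      have h1 : D₁.1.comap j = D₂.1.comap j := congrArg Subtype.val hD
      have h2 : stalkIdeal D₁.1 (j x') = stalkIdeal D₂.1 (j x') := by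
        rw [stalkIdeal_eq_map_symm_of_isLocalIso j D₁.1, stalkIdeal_eq_map_symm_of_isLocalIso j D₂.1, h1]
      exact Subtype.ext (hE.injOn_stalkIdeal (j x') D₁.1 D₁.2.1 D₂.1 D₂.2.1 D₁.2.2 D₂.2.2 h2)
    refine ⟨fun D => σ.symm (ι' (θ D)), fun D₁ D₂ heq => hθ (hι' (σ.symm.injective heq)), ?_⟩
    intro D
    rw [huσ, stalkIdeal_eq_map_symm_of_isLocalIso j, ← he_def,
      show stalkIdeal (D.1.comap j) x' = Ideal.span {u' (ι' (θ D))} from hι'D (θ D), Ideal.map_span,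
      Set.image_singleton]
  · -- the centre
    intro _
    obtain ⟨S, hS⟩ := hC' hx'C
    refine ⟨σ ⁻¹' S, ?_⟩
    rw [stalkIdeal_vanishingIdeal_closureImage_eq_map j hC, ← he_def, hS, Ideal.map_span,
      Set.image_image]
    congr 1
    rw [show u = (fun i => e.symm (u' i)) ∘ σ from rfl, Set.image_comp, σ.image_preimage]

end Centre

/-! ## The extension -/

namespace CentreSeq

/-- **Extension of a multiple blow-up from an open subscheme.** Let `j : U → X` be an open
immersion into a locally Noetherian scheme, `M = (X, 𝓘, E, μ)` a marked ideal whose boundary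
`E` has simple normal crossings, `T ⊆ j(U)` closed, and `s` a multiple blow-up of `j^*M`
(`IsAdmissibleFor`: regular centres inside the successive supports, simple normal crossings with
the boundaries) all of whose centres lie over `j⁻¹ T` (`CentresOver`). Then there is a multiple
blow-up `t` of `M`, with centres over `T`, which induces `s` along `j` (`IsPullbackAlong j t s`):
at each stage the centre of `t` is the (reduced) closure of the image of the centre of `s`, equal
to that image since it lies over the closed `T ⊆ j(U)`, and the tower over `U` is the preimage of
`U` (blow-ups commute with open immersions, GW Prop. 13.91).
[cite: BierstoneGrigorievMilmanWlodarczyk2011, Def. 3.1.5 Remark (1), Thm. 8.0.5 (2)]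
[cite: Kollar2007, Thm. 3.105 (proof)] -/
theorem exists_extend_of_centresOver {U : Scheme.{u}} (s : CentreSeq U) :
    ∀ {X : Scheme.{u}} [IsLocallyNoetherian X] (j : U ⟶ X) [IsOpenImmersion j]
      (M : MarkedIdeal X) (T : Set X), IsClosed T → T ⊆ Set.range j →
      HasSNC M.boundary → s.IsAdmissibleFor (M.comap j) → s.CentresOver (j ⁻¹' T) →
      ∃ t : CentreSeq X, t.IsAdmissibleFor M ∧ t.CentresOver T ∧ IsPullbackAlong j t s := by
  induction s with
  | nil U =>
    intro X _ j _ M T _ _ _ _ _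
    exact ⟨nil X, trivial, trivial, trivial⟩
  | cons C rest ih =>
    intro X _ j _ M T hT hTj hE hadm hover
    obtain ⟨hCsupp, hCsnc, hCreg, hrest⟩ := (isAdmissibleFor_cons C rest _).mp hadm
    obtain ⟨hCT, hrestT⟩ := (centresOver_cons C rest _).mp hover
    haveI : IsReduced C.subscheme := hCreg.isReduced
    have hC : C.radical = C := radical_eq_of_isReduced_subscheme C
    haveI : IsLocallyNoetherian _ := LocallyOfFiniteType.isLocallyNoetherian j
    haveI : IsLocallyNoetherian (blowup C) := isLocallyNoetherian_blowup C
    -- the extended centre `Z`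
    obtain ⟨Z, hZ⟩ : ∃ Z : X.IdealSheafData, Z = vanishingIdeal (closureImage j (C.support : Set _)) :=
      ⟨_, rfl⟩
    have hZj : Z.comap j = C := by rw [hZ]; exact comap_vanishingIdeal_closureImage_support j hC
    have hZT : (Z.support : Set X) ⊆ T := by
      rw [hZ]; exact support_vanishingIdeal_closureImage_subset j hT hCT
    have hZsnc : HasSNCWith M.boundary Z := by
      rw [hZ]; exact hE.hasSNCWith_vanishingIdeal_closureImage j hC hCsnc hT hTj hCT
    have hZreg : Scheme.IsRegular Z.subscheme := by
      rw [hZ]; exact isRegular_subscheme_vanishingIdeal_closureImage j hCreg hT hTj hCT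
    have hZsupp : (Z.support : Set X) ⊆ M.support := by
      intro y hy
      rw [hZ] at hy
      obtain ⟨x', rfl, hx'⟩ := exists_eq_of_mem_support_vanishingIdeal_closureImage j hC hT hTj hCT hy
      have := hCsupp hx'
      rw [MarkedIdeal.support_comap_of_isOpenImmersion] at this
      exact this
    haveI : IsLocallyNoetherian (blowup Z) := isLocallyNoetherian_blowup Z
    -- the comparison open immersion `g : Bl_C(U) ⟶ Bl_Z(X)` over `j`
    obtain ⟨g, _, hg, hgrange⟩ : ∃ (g : blowup C ⟶ blowup Z) (_ : IsOpenImmersion g),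
        g ≫ blowup.π Z = blowup.π C ≫ j ∧ Set.range g = blowup.π Z ⁻¹' Set.range j := by
      subst hZj
      exact ⟨blowup.map Z j, inferInstance, blowup.map_π Z j, blowup.range_map Z j⟩
    -- the hypotheses reproduce themselves one level up
    have hadm' : rest.IsAdmissibleFor ((M.transform (blowup.π Z) Z).comap g) := by
      rw [MarkedIdeal.transform_comap_of_isOpenImmersion j g hg Z M, hZj]
      exact hrest
    have hT' : IsClosed (blowup.π Z ⁻¹' T) := hT.preimage (blowup.π Z).continuous
    have hTj' : blowup.π Z ⁻¹' T ⊆ Set.range g := by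
      rw [hgrange]; exact Set.preimage_mono hTj
    have hover' : rest.CentresOver (g ⁻¹' (blowup.π Z ⁻¹' T)) := by
      have : g ⁻¹' (blowup.π Z ⁻¹' T) = blowup.π C ⁻¹' (j ⁻¹' T) := by
        rw [← Set.preimage_comp, ← Set.preimage_comp, ← TopCat.coe_comp, ← TopCat.coe_comp,
          ← Scheme.Hom.comp_base, ← Scheme.Hom.comp_base, hg]
      rw [this]; exact hrestT
    have hE' : HasSNC (M.transform (blowup.π Z) Z).boundary :=
      M.hasSNC_transform_boundary hZsnc (blowup.isBlowup Z)
    obtain ⟨rest', hadmR, hoverR, hpb⟩ :=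
      ih g (M.transform (blowup.π Z) Z) _ hT' hTj' hE' hadm' hover'
    refine ⟨cons Z rest', ?_, ?_, ?_⟩
    · exact (isAdmissibleFor_cons Z rest' M).mpr ⟨hZsupp, hZsnc, hZreg, hadmR⟩
    · exact (centresOver_cons Z rest' T).mpr ⟨hZT, hoverR⟩
    · exact ⟨hZj.symm, g, hg, hpb⟩

/-- An induced sequence has the same length (BGMW Thm. 8.0.5: the induced sequence `φ^*(X_i)`
is indexed like `(X_i)`). [cite: BierstoneGrigorievMilmanWlodarczyk2011, Thm. 8.0.5 (2)] -/
theorem IsPullbackAlong.length_eq : ∀ {X U : Scheme.{u}} {f : U ⟶ X} {t : CentreSeq X}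
    {s : CentreSeq U}, IsPullbackAlong f t s → t.length = s.length
  | _, _, _, nil _, nil _, _ => rfl
  | _, _, _, nil _, cons _ _, h => h.elim
  | _, _, _, cons _ _, nil _, h => h.elim
  | _, _, _, cons _ _, cons _ _, h => by
    obtain ⟨_, _, _, h'⟩ := h
    simp only [length]
    rw [IsPullbackAlong.length_eq h']

end CentreSeq

end Literature.AlgebraicGeometry.Resolution

end
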